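import Summits.QuantumFields.YangMills.Theorems.UniversalDetectorLatticeExtraction
import Summits.QuantumFields.YangMills.Theorems.UniversalDetectorMeshLimitCalculus

/-!
# Route `UniversalDetector`, support item `PlaneLimitExtraction` (stmt-QuantumFields-23251) — exact AND
approximate lattice symmetries pass to the extracted kernel (lattice-indexed mesh-limit calculus)

Ideator seat ym-idea-8 g7 (LINE 4 of rung R2a = `BalabanLadder.NT`).  Lattice-indexed companions of the g4 mesh
calculus (`exists_meshSeq_tendsto`, `tendsto_meshValues`, `meshLimit_invariant`), in the quantifier shape produced by
`latticeKernel_extraction`: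

* `exists_latticeSeq_tendsto` — every point is a limit of lattice points `s_{φ k} z_k`, `z_k ∈ box d L_{φ k}`;
* `eventually_mem_annulus` — a sequence converging to `x ≠ 0` eventually lies in a fixed annulus `η ≤ ‖·‖ ≤ η⁻¹`;
* `tendsto_latticeValues` — along such lattice sequences the kernels converge to `K x` (`x ≠ 0`);
* `latticeLimit_invariant_approx` — if lattice maps `τ_k` (box-stable, intertwining a continuous `σ` on `ℝ^d`)
  leave the kernels invariant UP TO A DEFECT THAT TENDS TO ZERO locally uniformly on annuli, then `K (σ x) = K x`
  for `x ≠ 0`, `σ x ≠ 0`.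

For the route: evenness (`τ z = -z`, exact: `cov_dens_zero_neg`) and coordinate permutations (exact:
`cov_dens_zero_perm`) have defect `0`; the time reflection (`τ = ϑ_site`, `σ = timeReflection 4`) has defect
`≤ Σ|ω_pq(s_k)| → 0` (`reflect_defect_of_tight6`).  At `x = 0` all three identities are trivial (`σ 0 = 0`).
Pure analysis; no summit, rung or crux is proved here.
-/

set_option autoImplicit false

noncomputable section

open Filter Topology
open Literature.MathematicalPhysics.QuantumLattice Literature.Probability.LatticeModels

namespace Summit.QuantumFields.YangMills.Cruxes.UniversalDetectorPlaneTight

/-- **Lattice points converging to any point.**  If `s_k → 0⁺` and `s_k L_k → ∞` then along any subsequence `φ`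
every point `x` is the limit of lattice points `s_{φ k} z_k` with `z_k ∈ box d L_{φ k}` (eventually). -/
theorem exists_latticeSeq_tendsto {d : ℕ} (s : ℕ → ℝ) (L : ℕ → ℕ) (hs : ∀ k, 0 < s k)
    (hs0 : Tendsto s atTop (𝓝 0)) (hL : Tendsto (fun k => s k * L k) atTop atTop)
    (φ : ℕ → ℕ) (hφ : StrictMono φ) (x : EuclideanSpace ℝ (Fin d)) :
    ∃ zs : ℕ → Site d, (∀ᶠ k in atTop, zs k ∈ box d (L (φ k))) ∧
      Tendsto (fun k => s (φ k) • siteToE (zs k)) atTop (𝓝 x) := by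
  classical
  have hD := latticeMesh_dense (d := d) s L hs hs0 hL
  obtain ⟨ws, hwS, hwx⟩ :=
    Summit.QuantumFields.YangMills.Cruxes.UniversalDetectorLimitExtraction.exists_meshSeq_tendsto d
      (fun k => (fun z : Site d => s k • siteToE z) '' (box d (L k) : Set (Site d))) (by
        intro δ R hδ hR
        obtain ⟨k₀, hk₀⟩ := hD δ R hδ hR
        refine ⟨k₀, fun k hk y hy => ?_⟩
        obtain ⟨z, hz, hzy⟩ := hk₀ k hk y hy
        exact ⟨s k • siteToE z, ⟨z, hz, rfl⟩, hzy⟩) φ hφ x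
  -- pull the mesh points back to lattice sites
  let zs : ℕ → Site d := fun k =>
    if h : ∃ z, z ∈ (box d (L (φ k)) : Set (Site d)) ∧ s (φ k) • siteToE z = ws k then h.choose else 0
  have hspec : ∀ k, ws k ∈ (fun z : Site d => s (φ k) • siteToE z) '' (box d (L (φ k)) : Set (Site d)) →
      zs k ∈ box d (L (φ k)) ∧ s (φ k) • siteToE (zs k) = ws k := by
    intro k hk
    have h : ∃ z, z ∈ (box d (L (φ k)) : Set (Site d)) ∧ s (φ k) • siteToE z = ws k := by
      obtain ⟨z, hz, hzw⟩ := hk; exact ⟨z, hz, hzw⟩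
    have hz : zs k = h.choose := dif_pos h
    rw [hz]
    exact ⟨Finset.mem_coe.1 h.choose_spec.1, h.choose_spec.2⟩
  refine ⟨zs, ?_, ?_⟩
  · filter_upwards [hwS] with k hk using (hspec k hk).1
  · refine hwx.congr' ?_
    filter_upwards [hwS] with k hk using (hspec k hk).2.symm

/-- A sequence converging to `x ≠ 0` eventually lies in a fixed annulus `η ≤ ‖·‖ ≤ η⁻¹`. -/
theorem eventually_mem_annulus {d : ℕ} {x : EuclideanSpace ℝ (Fin d)} (hx : x ≠ 0)
    {u : ℕ → EuclideanSpace ℝ (Fin d)} (hu : Tendsto u atTop (𝓝 x)) :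
    ∃ η : ℝ, 0 < η ∧ ∀ᶠ k in atTop, η ≤ ‖u k‖ ∧ ‖u k‖ ≤ η⁻¹ := by
  have hxpos : 0 < ‖x‖ := norm_pos_iff.mpr hx
  refine ⟨min (‖x‖ / 2) (2 * ‖x‖)⁻¹, by positivity, ?_⟩
  have hev : ∀ᶠ k in atTop, dist (u k) x < ‖x‖ / 2 := Metric.tendsto_nhds.1 hu _ (half_pos hxpos)
  filter_upwards [hev] with k hk
  rw [dist_eq_norm] at hk
  have h1 : ‖x‖ - ‖u k - x‖ ≤ ‖u k‖ := by
    have := norm_sub_norm_le x (u k); rw [norm_sub_rev] at this; linarith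
  have h2 : ‖u k‖ ≤ ‖x‖ + ‖u k - x‖ := by
    have := norm_add_le x (u k - x); rwa [add_sub_cancel] at this
  constructor
  · exact (min_le_left _ _).trans (by linarith)
  · have h3 : 2 * ‖x‖ ≤ (min (‖x‖ / 2) (2 * ‖x‖)⁻¹)⁻¹ := by
      rw [← le_inv_comm₀ (by positivity) (by positivity)]
      exact min_le_right _ _
    linarith

/-- **Evaluation of the lattice limit.**  Under the approximation and continuity clauses of
`latticeKernel_extraction`, along any lattice sequence `s_{φ k} z_k → x ≠ 0` (`z_k ∈ box` eventually) the kernel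
values `g (φ k) z_k` converge to `K x`. -/
theorem tendsto_latticeValues {d : ℕ} (s : ℕ → ℝ) (L : ℕ → ℕ) (g : ℕ → Site d → ℝ) (φ : ℕ → ℕ)
    (K : EuclideanSpace ℝ (Fin d) → ℝ)
    (happrox : ∀ η ε : ℝ, 0 < η → 0 < ε → ∃ k₀ : ℕ, ∀ k : ℕ, k₀ ≤ k → ∀ z ∈ box d (L (φ k)),
      η ≤ ‖s (φ k) • siteToE z‖ → ‖s (φ k) • siteToE z‖ ≤ η⁻¹ → |g (φ k) z - K (s (φ k) • siteToE z)| ≤ ε)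
    (hcont : ContinuousOn K {z | z ≠ 0}) (x : EuclideanSpace ℝ (Fin d)) (hx : x ≠ 0) (zs : ℕ → Site d)
    (hzs : ∀ᶠ k in atTop, zs k ∈ box d (L (φ k)))
    (hzx : Tendsto (fun k => s (φ k) • siteToE (zs k)) atTop (𝓝 x)) :
    Tendsto (fun k => g (φ k) (zs k)) atTop (𝓝 (K x)) := by
  obtain ⟨η, hη, hann⟩ := eventually_mem_annulus hx hzx
  have hKz : Tendsto (fun k => K (s (φ k) • siteToE (zs k))) atTop (𝓝 (K x)) :=
    ((hcont x hx).continuousAt (isOpen_ne.mem_nhds hx)).tendsto.comp hzx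
  have hdiff : Tendsto (fun k => g (φ k) (zs k) - K (s (φ k) • siteToE (zs k))) atTop (𝓝 0) := by
    rw [Metric.tendsto_nhds]
    intro ε hε
    obtain ⟨k₀, hk₀⟩ := happrox η (ε / 2) hη (half_pos hε)
    filter_upwards [hann, hzs, eventually_ge_atTop k₀] with k hk hkz hk0
    rw [dist_zero_right, Real.norm_eq_abs]
    exact (hk₀ k hk0 (zs k) hkz hk.1 hk.2).trans_lt (half_lt_self hε)
  have := hdiff.add hKz
  simpa using this

/-- **Approximate lattice symmetries pass to the limit kernel.**  Setting of `latticeKernel_extraction` (spacings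
`s_k → 0⁺`, `s_k L_k → ∞`, kernels `g k` on `box d L_k`, a subsequence `φ` and limit `K` with the approximation and
continuity clauses).  Let `τ_k : Site d → Site d` be lattice maps which, eventually, preserve `box d L_{φ k}` and
intertwine a map `σ` of `ℝ^d` (`s_{φ k} τ_k z = σ (s_{φ k} z)`), and suppose the kernels are `τ_k`-invariant up to
a defect tending to `0` locally uniformly on annuli.  Then `K (σ x) = K x` whenever `x ≠ 0`, `σ x ≠ 0` and `σ` is
continuous at `x`. -/
theorem latticeLimit_invariant_approx {d : ℕ} (s : ℕ → ℝ) (L : ℕ → ℕ) (g : ℕ → Site d → ℝ) (hs : ∀ k, 0 < s k)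
    (hs0 : Tendsto s atTop (𝓝 0)) (hL : Tendsto (fun k => s k * L k) atTop atTop)
    (φ : ℕ → ℕ) (hφ : StrictMono φ) (K : EuclideanSpace ℝ (Fin d) → ℝ)
    (happrox : ∀ η ε : ℝ, 0 < η → 0 < ε → ∃ k₀ : ℕ, ∀ k : ℕ, k₀ ≤ k → ∀ z ∈ box d (L (φ k)),
      η ≤ ‖s (φ k) • siteToE z‖ → ‖s (φ k) • siteToE z‖ ≤ η⁻¹ → |g (φ k) z - K (s (φ k) • siteToE z)| ≤ ε)
    (hcont : ContinuousOn K {z | z ≠ 0})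
    (τ : ℕ → Site d → Site d) (σ : EuclideanSpace ℝ (Fin d) → EuclideanSpace ℝ (Fin d))
    (hτ : ∀ᶠ k in atTop, ∀ z ∈ box d (L (φ k)),
      τ k z ∈ box d (L (φ k)) ∧ s (φ k) • siteToE (τ k z) = σ (s (φ k) • siteToE z))
    (hinv : ∀ η ε : ℝ, 0 < η → 0 < ε → ∀ᶠ k in atTop, ∀ z ∈ box d (L (φ k)),
      η ≤ ‖s (φ k) • siteToE z‖ → ‖s (φ k) • siteToE z‖ ≤ η⁻¹ → |g (φ k) (τ k z) - g (φ k) z| ≤ ε)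
    (x : EuclideanSpace ℝ (Fin d)) (hx : x ≠ 0) (hσx : σ x ≠ 0) (hσc : ContinuousAt σ x) :
    K (σ x) = K x := by
  obtain ⟨zs, hzs, hzx⟩ := exists_latticeSeq_tendsto s L hs hs0 hL φ hφ x
  have h1 : Tendsto (fun k => g (φ k) (zs k)) atTop (𝓝 (K x)) :=
    tendsto_latticeValues s L g φ K happrox hcont x hx zs hzs hzx
  have hτzs : ∀ᶠ k in atTop, τ k (zs k) ∈ box d (L (φ k)) ∧
      s (φ k) • siteToE (τ k (zs k)) = σ (s (φ k) • siteToE (zs k)) := by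
    filter_upwards [hzs, hτ] with k hk hτk using hτk _ hk
  have h2 : Tendsto (fun k => g (φ k) (τ k (zs k))) atTop (𝓝 (K (σ x))) := by
    refine tendsto_latticeValues s L g φ K happrox hcont (σ x) hσx (fun k => τ k (zs k))
      (hτzs.mono fun k hk => hk.1) ?_
    exact (hσc.tendsto.comp hzx).congr' (by filter_upwards [hτzs] with k hk using hk.2.symm)
  have h3 : Tendsto (fun k => g (φ k) (τ k (zs k)) - g (φ k) (zs k)) atTop (𝓝 0) := by
    obtain ⟨η, hη, hann⟩ := eventually_mem_annulus hx hzx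
    rw [Metric.tendsto_nhds]
    intro ε hε
    filter_upwards [hann, hzs, hinv η (ε / 2) hη (half_pos hε)] with k hk hkz hkinv
    rw [dist_zero_right, Real.norm_eq_abs]
    exact (hkinv (zs k) hkz hk.1 hk.2).trans_lt (half_lt_self hε)
  have h4 : Tendsto (fun k => g (φ k) (τ k (zs k))) atTop (𝓝 (0 + K x)) := by
    have := h3.add h1
    simpa only [sub_add_cancel] using this
  rw [zero_add] at h4
  exact tendsto_nhds_unique h2 h4

end Summit.QuantumFields.YangMills.Cruxes.UniversalDetectorPlaneTight

end
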